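import Literature.IUT.LogThetaLattice.GlobalLGPFrobenioidsRealifiedPrimes
import HarnessLib

/-!
# [IUTchIII] Proposition 3.7 (iii)/(iv) «Prime(†𝒞^⊩_lgp) ⥲ V̲», «†ρ_{lgp,v}», H: the places dictionary — the divisor
# monoid of the CATEGORICAL `(†𝓕⊛ℝ_𝔪𝔬𝔡)_α` IS `Φ_{𝒞⊩_mod}` of [IUTchI] Ex. 3.5 (i) in `V_mod`-coordinates

abc-iut cell, layer L6, wave-5 seat abc-iut-w5-d153 (gen 2); part H of the lineage (D: `primesEquivPlaces :
Primes(Φ^rlf(∗)) ≃ ModelPlaces F`, `localDeg`), the «†ρ_{lgp,v} place-parametrisation bridge» named as residual by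
abc-iut-L6-t4 (gen 3, 02:08:50Z) and in part D's header: abc-iut-L6-d1's `ModelPlaces F =
HeightOneSpectrum (𝓞 F) ⊕ InfinitePlace F` versus abc-iut-L5-t1/t2's `Val F = InfinitePlace F ⊕ FinitePlace F`
([IUTchI] §0 "`V(F)`"), in which [IUTchI] Ex. 3.5 (i)'s `Φ_{𝒞⊩_mod}` (`InitialThetaData.PhiMod = V_mod →₀ ℝ≥0`), its
`ρ_v` (`InitialThetaData.rho`) and abc-iut-w4-d013's divisor-level `†𝒞^⊩_lgp` (`PhiFrakRlf D j := D.PhiMod`,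
`primesLgpEquiv`) are written.

PRINT. [IUTchIII] Prop. 3.7 (iv) p. 111 "`†𝔉^⊩_lgp = (†𝒞^⊩_lgp, Prime(†𝒞^⊩_lgp) ⥲ V̲, †𝔉^⊢_lgp, {†ρ_{lgp,v}}_{v∈V̲})`"
[claim key Mochizuki2012, status disputed (D-0012)]; [IUTchI] Ex. 3.5 (i) p. 77 ("`Prime(𝒞^⊩_mod) ⥲ V_mod`",
"`ρ_v : Φ_{𝒞^⊩_mod,v} ⥲ Φ^rlf_{𝒞^⊢_v}`"), Def. 3.1 (e) ("`V̲ ⥲ V_mod`"); [FrdI] Ex. 6.3 p. 113 ("`Prime(Φ(L)) ≃ V(L)`")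
[cite: MochizukiFrdI2008, Ex. 6.3 p.113].

CONTENTS (ns `Literature.IUT.LogThetaLattice.Prop37.FrakRlfCat`):
* `modelPlacesEquivVal : ModelPlaces F ≃ Val F` (Mathlib `FinitePlace.mk` / `maximalIdeal`; inverse =
  abc-iut-w4-d005's `toModelPlace`, `modelPlacesEquivVal_symm_apply`);
* `effDivAddEquivVal : Φ^rlf(∗) ≃+ (Val F →₀ ℝ≥0)` (part D's `effDivAddEquiv` reindexed), `effDivAddEquivVal_delta`
  (`δ_p ↦ single p 1`), `primesEquivVal : Primes(Φ^rlf(∗)) ≃ Val F` and **`primesEquivVal_eq_congr`** — it coincides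
  with the transport of abc-iut-w4-d013's `FinsuppNNReal.primesEquiv` along `effDivAddEquivVal` (the form in which
  `primesLGPEquiv` / `primesLgpEquiv` are built);
* for an initial Θ-datum `D` ([IUTchI] Def. 3.1, abc-iut-L5-t2) with `F_mod = fieldOfModuli E`:
  **`effDivEquivPhiMod D : Φ^rlf(∗)(F_mod) ≃+ D.PhiMod = Φ_{𝒞⊩_mod}`** (the divisor monoid of the categorical
  `(†𝓕⊛ℝ_𝔪𝔬𝔡)_α` at `F_mod` IS [IUTchI] Ex. 3.5 (i)'s `Φ_{𝒞⊩_mod}`; `= PhiFrakRlf D j` of abc-iut-w4-d013 by definition),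
  `effDivEquivPhiMod_delta` (`δ_p ↦ log⊢_mod(p_v)`, `InitialThetaData.logMod`), and **`rhoLgp D w`** — print's
  `†ρ_{lgp,v}` for the categorical Frobenioid: abc-iut-L5-t2's `ρ_v̲` (`InitialThetaData.rho`) precomposed with part
  D's `v`-component `localDeg` at the place `v ∈ V_mod` below `w = v̲` (`toVMod`); `rhoLgp_apply`.
No `Prop`-valued definition; nothing here asserts a disputed claim or takes a side on [IUTchIII] Cor. 3.12; typed ≠
discharged; instantiated ≠ endorsed.
-/

noncomputable section

namespace Literature.IUT.LogThetaLattice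

namespace Prop37

namespace FrakRlfCat

open NumberField IsDedekindDomain GlobalFrobenioidModels Literature.AlgebraicGeometry.Frobenioids
  Literature.IUT.HodgeTheaters
open scoped NNReal

variable (F : Type) [Field F] [NumberField F]

/-! ### The places dictionary `ModelPlaces F ≃ Val F` -/

/-- **`ModelPlaces F ≃ V(F)`**: abc-iut-L6-d1's model places (maximal ideals `⊕` infinite places) versus
abc-iut-L5's valuations `V(F) = V(F)^arc ∪ V(F)^non` (infinite places `⊕` Mathlib finite places), via Mathlib's
`FinitePlace.mk` / `FinitePlace.maximalIdeal`. [cite: Mochizuki2012, §0 p.35] -/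
def modelPlacesEquivVal : ModelPlaces F ≃ Val F where
  toFun p := match p with
    | .inl v => Sum.inr (FinitePlace.mk v)
    | .inr w => Sum.inl w
  invFun q := match q with
    | .inl w => Sum.inr w
    | .inr w => Sum.inl (FinitePlace.maximalIdeal w)
  left_inv p := by
    rcases p with v | w
    · show (Sum.inl (FinitePlace.maximalIdeal (FinitePlace.mk v)) : ModelPlaces F) = Sum.inl v
      rw [FinitePlace.maximalIdeal_mk]
    · rfl
  right_inv q := by
    rcases q with w | w
    · rfl
    · show (Sum.inr (FinitePlace.mk (FinitePlace.maximalIdeal w)) : Val F) = Sum.inr w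
      rw [FinitePlace.mk_maximalIdeal]

/-- The inverse dictionary `V(F) → ModelPlaces F` IS abc-iut-w4-d005's `toModelPlace` (layer L1's `Places F` and
abc-iut-L5's `Val F` are the same disjoint union). [cite: Mochizuki2012, §0 p.35] -/
theorem modelPlacesEquivVal_symm_apply (q : Val F) : (modelPlacesEquivVal F).symm q = toModelPlace F q := by
  rcases q with w | w <;> rfl

/-- `modelPlacesEquivVal` on a maximal ideal: the corresponding finite place. [cite: Mochizuki2012, §0 p.35] -/
@[simp] theorem modelPlacesEquivVal_inl (v : HeightOneSpectrum (𝓞 F)) :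
    modelPlacesEquivVal F (Sum.inl v) = (Sum.inr (FinitePlace.mk v) : Val F) := rfl

/-- `modelPlacesEquivVal` on an infinite place: itself. [cite: Mochizuki2012, §0 p.35] -/
@[simp] theorem modelPlacesEquivVal_inr (w : InfinitePlace F) :
    modelPlacesEquivVal F (Sum.inr w) = (Sum.inl w : Val F) := rfl

/-! ### `Φ^rlf(∗) ≅ ⊕_{v ∈ V(F)} ℝ_{≥0}` in `V(F)`-coordinates and the primes -/

/-- **`Φ^rlf(∗) ≃+ (V(F) →₀ ℝ_{≥0})`**: the divisor monoid of the categorical realified Frobenioid `(†𝓕⊛ℝ_𝔪𝔬𝔡)_α`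
(part D's `effDivAddEquiv`) reindexed by the places dictionary — the coordinates of [IUTchI] Ex. 3.5 (i).
[cite: MochizukiFrdI2008, Thm. 6.4 (i) p.115] -/
def effDivAddEquivVal : effDiv (ModelPlaces F) (fun _ => ℝ) nonnegModel ≃+ (Val F →₀ ℝ≥0) :=
  (effDivAddEquiv F).trans (Finsupp.domCongr (modelPlacesEquivVal F))

/-- `effDivAddEquivVal D q = D_{p(q)}`, `p(q)` the model place of `q`. [cite: MochizukiFrdI2008, Thm. 6.4 (i) p.115] -/
theorem coe_effDivAddEquivVal_apply (D : effDiv (ModelPlaces F) (fun _ => ℝ) nonnegModel) (q : Val F) :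
    (effDivAddEquivVal F D q : ℝ) = (D : ModelFrakObj F).cls ((modelPlacesEquivVal F).symm q) := rfl

/-- `δ_p ↦ single (place of p) 1`. [cite: MochizukiFrdI2008, §0 p.12] -/
theorem effDivAddEquivVal_delta (p : ModelPlaces F) :
    effDivAddEquivVal F (delta F p) = Finsupp.single (modelPlacesEquivVal F p) 1 := by
  show Finsupp.domCongr (modelPlacesEquivVal F) (effDivAddEquiv F (delta F p)) = _
  rw [effDivAddEquiv_delta]
  exact Finsupp.equivMapDomain_single _ _ _

/-- `single q 1 ↦ δ_{p(q)}` under the inverse. [cite: MochizukiFrdI2008, §0 p.12] -/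
theorem effDivAddEquivVal_symm_single (q : Val F) :
    (effDivAddEquivVal F).symm (Finsupp.single q 1) = delta F ((modelPlacesEquivVal F).symm q) :=
  (effDivAddEquivVal F).injective (by
    rw [AddEquiv.apply_symm_apply, effDivAddEquivVal_delta, Equiv.apply_symm_apply])

/-- **`Prime(Φ^rlf(∗)) ≃ V(F)`** — "`Prime(†𝒞^⊩_lgp) ⥲ V̲ ⥲ V_mod`" for the categorical realified Frobenioid, in
abc-iut-L5's places (part D's `primesEquivPlaces` followed by the dictionary). [claim: Mochizuki2012, status: disputed] -/
def primesEquivVal : Primes (EffDiv (ModelPlaces F) (fun _ => ℝ) nonnegModel) ≃ Val F :=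
  (primesEquivPlaces F).trans (modelPlacesEquivVal F)

/-- The prime of `δ_p` is the place of `p`. [claim: Mochizuki2012, status: disputed] -/
theorem primesEquivVal_delta (p : ModelPlaces F) :
    primesEquivVal F (Quotient.mk (primarySetoid _) ⟨Multiplicative.ofAdd (delta F p), isPrimary_delta F p⟩) =
      modelPlacesEquivVal F p := by
  show modelPlacesEquivVal F (primesEquivPlaces F _) = _
  rw [primesEquivPlaces_delta]

/-- Every place is the prime of its `δ`. [claim: Mochizuki2012, status: disputed] -/
theorem primesEquivVal_symm_apply (q : Val F) :
    (primesEquivVal F).symm q =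
      Quotient.mk (primarySetoid _) ⟨Multiplicative.ofAdd (delta F ((modelPlacesEquivVal F).symm q)),
        isPrimary_delta F _⟩ :=
  primesEquivPlaces_symm_apply F _

/-- **The two routes to `Prime(Φ^rlf(∗)) ≃ V(F)` agree**: part D's `primesEquivPlaces` + the dictionary EQUALS the
transport of abc-iut-w4-d013's `FinsuppNNReal.primesEquiv` along `effDivAddEquivVal` (the shape in which
abc-iut-w4-d013's `primesLGPEquiv` / `primesLgpEquiv` and abc-iut-L5-t2's `Prime(𝒞^⊩_mod) ⥲ V_mod` are built) — both
send the prime of `δ_p` to the place of `p`. [claim: Mochizuki2012, status: disputed] -/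
theorem primesEquivVal_eq_congr :
    primesEquivVal F =
      (Primes.congr (AddEquiv.toMultiplicative (effDivAddEquivVal F))).trans FinsuppNNReal.primesEquiv := by
  have hsymm : (primesEquivVal F).symm =
      ((Primes.congr (AddEquiv.toMultiplicative (effDivAddEquivVal F))).trans FinsuppNNReal.primesEquiv).symm := by
    refine Equiv.ext fun q => ?_
    rw [primesEquivVal_symm_apply, Equiv.symm_trans_apply, Primes.congr_symm]
    have hq : (FinsuppNNReal.primesEquiv (ι := Val F)).symm q =
        Quotient.mk (primarySetoid _) ⟨Multiplicative.ofAdd (Finsupp.single q 1), FinsuppNNReal.isPrimary_single q⟩ :=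
      FinsuppNNReal.primesEquiv.injective (by rw [Equiv.apply_symm_apply, FinsuppNNReal.primesEquiv_mk_single])
    rw [hq, Primes.congr_mk _ _ (FinsuppNNReal.isPrimary_single q) (by
      rw [← isPrimary_map_iff (AddEquiv.toMultiplicative (effDivAddEquivVal F)), MulEquiv.apply_symm_apply]
      exact FinsuppNNReal.isPrimary_single q)]
    congr 1
    apply Subtype.ext
    show Multiplicative.ofAdd (delta F ((modelPlacesEquivVal F).symm q)) =
      Multiplicative.ofAdd ((effDivAddEquivVal F).symm (Finsupp.single q 1))
    rw [effDivAddEquivVal_symm_single]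
  calc primesEquivVal F = (primesEquivVal F).symm.symm := (Equiv.symm_symm _).symm
    _ = _ := by rw [hsymm, Equiv.symm_symm]

/-! ### At an initial Θ-datum: `Φ^rlf(∗)(F_mod) = Φ_{𝒞⊩_mod}` and `†ρ_{lgp,v}` -/

section InitialTheta

variable {F₀ K Fbar : Type} [Field F₀] [NumberField F₀] [Field K] [NumberField K] [Algebra F₀ K] [Field Fbar]
  [Algebra F₀ Fbar] [Algebra K Fbar] {E : WeierstrassCurve F₀} [E.IsElliptic] {l : ℕ} {P : BadPlacePredicates K}
  (D : InitialThetaData F₀ K Fbar E l P)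

/-- **The divisor monoid of the categorical `(†𝓕⊛ℝ_𝔪𝔬𝔡)_α` at the field of moduli IS `Φ_{𝒞⊩_mod}`** of [IUTchI]
Ex. 3.5 (i) (abc-iut-L5-t2's `InitialThetaData.PhiMod = V_mod →₀ ℝ_{≥0}`; = abc-iut-w4-d013's `PhiFrakRlf D j`, the
divisor monoid of `(†𝓕⊛ℝ_𝔪𝔬𝔡)_j` at divisor level, BY DEFINITION of the latter).
[claim: Mochizuki2012, status: disputed] -/
def effDivEquivPhiMod : effDiv (ModelPlaces (fieldOfModuli E)) (fun _ => ℝ) nonnegModel ≃+ D.PhiMod :=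
  effDivAddEquivVal (fieldOfModuli E)

/-- … and IS abc-iut-w4-d013's `PhiFrakRlf D j` (every label `j`). [claim: Mochizuki2012, status: disputed] -/
def effDivEquivPhiFrakRlf (j : Fin (lStar l)) :
    effDiv (ModelPlaces (fieldOfModuli E)) (fun _ => ℝ) nonnegModel ≃+ PhiFrakRlf D j :=
  effDivEquivPhiMod D

/-- **`δ_p ↦ log⊢_mod(p_v)`**: the generator of the prime of `p` goes to abc-iut-L5-t2's coordinate vector
`InitialThetaData.logMod v` at the place `v` of `p`. [claim: Mochizuki2012, status: disputed] -/
theorem effDivEquivPhiMod_delta (p : ModelPlaces (fieldOfModuli E)) :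
    effDivEquivPhiMod D (delta (fieldOfModuli E) p) = D.logMod (modelPlacesEquivVal (fieldOfModuli E) p) :=
  effDivAddEquivVal_delta (fieldOfModuli E) p

/-- **`Prime((†𝓕⊛ℝ_𝔪𝔬𝔡)_α) ⥲ V_mod` agrees with the `Φ_{𝒞⊩_mod}`-coordinates**: `primesEquivVal` at `F_mod` is the
transport of `FinsuppNNReal.primesEquiv` along `effDivEquivPhiMod` (so it matches abc-iut-w4-d013's `primesLgpEquiv`
up to his `phiLgp D ≃+ D.PhiMod`). [claim: Mochizuki2012, status: disputed] -/
theorem primesEquivVal_fieldOfModuli_eq :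
    primesEquivVal (fieldOfModuli E) =
      (Primes.congr (AddEquiv.toMultiplicative (effDivEquivPhiMod D))).trans FinsuppNNReal.primesEquiv :=
  primesEquivVal_eq_congr (fieldOfModuli E)

/-- **`†ρ_{lgp,v}` for the categorical realified Frobenioid** ([IUTchIII] Prop. 3.7 (iv); [IUTchI] Ex. 3.5 (i)
"`ρ_v : Φ_{𝒞^⊩_mod,v} ⥲ Φ^rlf_{𝒞^⊢_v}`"): abc-iut-L5-t2's `ρ_v̲ = InitialThetaData.rho w` precomposed with part D's
`v`-component `localDeg` of `Φ^rlf(∗)` at the place `v ∈ V_mod` below `w = v̲ ∈ V(K)` (`toVMod`).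
[claim: Mochizuki2012, status: disputed] -/
def rhoLgp (w : Val K) :
    EffDiv (ModelPlaces (fieldOfModuli E)) (fun _ => ℝ) nonnegModel →* Multiplicative (D.PhiDashRlf w) :=
  (AddMonoidHom.toMultiplicative (D.rho w)).comp
    (localDeg (fieldOfModuli E) ((modelPlacesEquivVal (fieldOfModuli E)).symm (toVMod F₀ K E w)))

/-- `†ρ_{lgp,v}` on an effective real family: `ρ_v̲` of its `v`-component. [claim: Mochizuki2012, status: disputed] -/
theorem rhoLgp_apply (w : Val K) (Dv : EffDiv (ModelPlaces (fieldOfModuli E)) (fun _ => ℝ) nonnegModel) :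
    rhoLgp D w Dv =
      Multiplicative.ofAdd (D.rho w (Multiplicative.toAdd
        (localDeg (fieldOfModuli E) ((modelPlacesEquivVal (fieldOfModuli E)).symm (toVMod F₀ K E w)) Dv))) :=
  rfl

/-- `†ρ_{lgp,v}` reads the `v`-coordinate of `Φ_{𝒞⊩_mod}`: through `effDivEquivPhiMod`, `rhoLgp w` is `ρ_w` applied
to the coordinate at `toVMod w`. [claim: Mochizuki2012, status: disputed] -/
theorem rhoLgp_ofAdd (w : Val K) (Dv : effDiv (ModelPlaces (fieldOfModuli E)) (fun _ => ℝ) nonnegModel) :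
    Multiplicative.toAdd (rhoLgp D w (Multiplicative.ofAdd Dv)) =
      D.rho w (effDivEquivPhiMod D Dv (toVMod F₀ K E w)) :=
  rfl

end InitialTheta

end FrakRlfCat

end Prop37

end Literature.IUT.LogThetaLattice

end
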